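import Mathlib
import HarnessLib
import Summits.RiemannHypothesis.RiemannHypothesis.Theorems.MayerPairingBranchPairingDefs
import Summits.RiemannHypothesis.RiemannHypothesis.Theorems.MayerPairingBranchPairingWeinsteinAronszajnRankOne

/-!
# Crux `MayerPairing.BranchPairing` (stmt-RiemannHypothesis-1471), line `weinstein-aronszajn-pinning`:
STUB 1 `stub_weinsteinAronszajn`

Route `RiemannHypothesis/MayerPairing`, crux `BranchPairing` (item stmt-RiemannHypothesis-1471), line
`weinstein-aronszajn-pinning`; helper file (supports 1471). The registered stub
`stub_weinsteinAronszajn : WeinsteinAronszajn` of the checked skeleton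
`Cruxes/BranchPairing/Lines/weinstein-aronszajn-pinning.lean`:
off the spectrum of the pinned operator `L̃_s = L_s + c(s)·(𝟙 ⊗ δ₀)` (`pinnedTransfer s`),
`μ ∈ spec L_s ↔ 1 + c(s)·δ₀((μ − L̃_s)⁻¹ 𝟙) = 0` — the instance `E := MayerSpace`,
`T := mayerTransfer s`, `φ := ev0 = δ₀`, `u := oneB = 𝟙`, `c := pinCoeff s` of the general rank-one
Weinstein–Aronszajn equivalence `weinsteinAronszajn_rankOne`
(`Theorems/MayerPairingBranchPairingWeinsteinAronszajnRankOne.lean`; T. Kato, *Perturbation theory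
for linear operators* (1966), IV-§6.1–6.2). No property of Mayer's operator is used.
-/

namespace Summit.RiemannHypothesis.RiemannHypothesis.Theorems.MayerPairingPinning

open Literature.Dynamics.TransferOperators

/-- **STUB 1 (M) of line `weinstein-aronszajn-pinning`** — the Weinstein–Aronszajn / Sherman–Morrison
secular equation for Mayer's operator and its rank-one pinning: for all `s μ : ℂ` with
`μ ∉ spec (pinnedTransfer s)`, `μ ∈ spec (mayerTransfer s) ↔ 1 + pinCoeff s * pinnedG s μ = 0`.
Instance of `weinsteinAronszajn_rankOne` (`pinnedTransfer s = mayerTransfer s + pinCoeff s • pinK`,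
`pinK = ev0.smulRight oneB`, `pinnedG s μ = ev0 (resolvent (pinnedTransfer s) μ oneB)`, all by `rfl`).
[folklore] -/
theorem stub_weinsteinAronszajn : WeinsteinAronszajn := fun s μ h =>
  weinsteinAronszajn_rankOne MayerSpace (mayerTransfer s) ev0 oneB (pinCoeff s) μ h

end Summit.RiemannHypothesis.RiemannHypothesis.Theorems.MayerPairingPinning
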